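import Mathlib

/-!
# `Balaban1983to89.B11Eq22Remainder` — [Balaban1985Variational] Sect. B, displays (22)–(23): the integral
# Taylor remainder `R_n` of the exponential and its two bounds, PROVED in a Banach algebra

statement-level skeleton of published theorems with citation tags; proofs where landed; nothing here is a claim about the Yang–Mills mass gap

CITATION HEADER (lean-in-tree rule 2026-08-18).  T. Bałaban, *The variational problem and background fields in
renormalization group method for lattice gauge theories*, Commun. Math. Phys. **102**, 277–309 (1985),
doi:10.1007/bf01229381 [Balaban1985Variational] (cell paper B11; held `paper:balaban1985-cmp102-variational-background`,
journal page = PDF page + 276).  Source of every quotation: the page render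
`run/shared/lean/pub/pub-balaban/b2b-balaban-ref1/pages/1985-cmp102-variational-background/1985-cmp102-variational-background-p005-x2.png`
(journal p. 281), READ AS AN IMAGE by this seat (lit-balaban reader/typer r08, 2026-08-20), cross-checked against the
render-verified transcript `run/shared/lean/pub/pub-balaban/b2b-balaban-b11/transcript.md` (p. 281 §B).

THE PRINT (p. 281 [PDF 5], Sect. B "An Expansion of the Action", verbatim).  *«We expand the action up to fourth order
in A. We take U₁ = e^{iηA} = 1 + iηA + (iη)²/2! A² + (iη)³/3! A³ + (iη)⁴/4! A⁴R₄(iηA), (22) where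
R_n(z) = ∫₀¹ dt n(1 − t)^{n−1} e^{tz}, |R_n(iX)| ≤ 1 for arbitrary hermitian matrix X, |R_n(X)| ≤ e^{|X|} for arbitrary
matrix X. (23)»*  Downstream use in the paper: (31) p. 282 *«|V₄(A, ∂p)| ≤ (1/4!)(|A|(∂p))⁴ e^{η|A|(∂p)}»* and (33).

WHAT IS HERE (all PROVED, Mathlib only).  For a complete normed algebra `𝔸` over `ℝ` (so in particular over `ℂ`, via
`NormedAlgebra.complexToReal`) and `X : 𝔸`:
* `expRemainder n X` — the printed `R_n(X) = ∫₀¹ n(1 − t)^{n−1} e^{tX} dt` as a Bochner integral (`NormedSpace.exp`);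
  `taylorPoly n X = Σ_{m<n} X^m/m!`;
* `expRemainder_one_mul`, `expRemainder_succ` — `X·R₁(X) = e^X − 1` and the integration-by-parts recursion
  `R_n(X) = 1 + (n+1)⁻¹ X R_{n+1}(X)` (fundamental theorem of calculus for `t ↦ (1 − t)^n e^{tX}`);
* `exp_eq_taylorPoly_add_remainder` — **(22) for every order**: `e^X = Σ_{m<n} X^m/m! + (X^n/n!) R_n(X)`, `n ≥ 1`
  (the printed (22) is `n = 4`, `X = iηA`: `exp_eq_taylor_four`);
* `norm_expRemainder_le_exp_norm` — **(23), second clause**: `‖R_n(X)‖ ≤ e^{‖X‖}` (here `‖1‖ = 1` is assumed,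
  `NormOneClass`, as for matrices with an operator norm); `norm_taylorTerm_le` — the (31)-shape consequence
  `‖(X^n/n!) R_n(X)‖ ≤ (‖X‖^n/n!) e^{‖X‖}` for ONE exponential (the plaquette quantity `V₄(A, ∂p)` of (29)–(31) is a
  product of four exponentials and is NOT defined here);
* `norm_expRemainder_I_smul_le_one` — **(23), first clause**: `‖R_n(iX)‖ ≤ 1` for `X` selfadjoint in a C⋆-algebra
  (Mathlib `CStarAlgebra`; the printed "hermitian matrix" with the operator norm is the instance `Matrix.instCStarAlgebra`
  of `Mathlib.Analysis.CStarAlgebra.Matrix`, scoped `Matrix.L2OpNorm`): `e^{itX}` is unitary (`selfAdjoint.expUnitary`),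
  hence of norm `1`, and `∫₀¹ n(1 − t)^{n−1} dt = 1`.
* v2 (append-only): **(38) p. 284** *«|η^{-2}(Re U₀(∂p) − 1)| < C₁B₃ε₁(L^jη)^{-2}, p ∈ Ω_j, (38)»* from the
  assumption (14)/(2) `|U₀(∂p) − 1| < C₁B₃ε₁η²(L^jη)^{-2}`: the C⋆-algebra fact `‖Re U − 1‖ ≤ ‖U − 1‖`
  (`norm_realPart_sub_one_le`, Re U = ½(U + U*) = Mathlib `realPart`) and the scale arithmetic (`ineq38`).
Reading conventions: `|·|` of the print = the norm of `𝔸`; `R_0 = 0` (the print uses `n ≥ 1` only).  Unit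
`lit-balaban-r08` (reader/typer of CMP 102:277, skeleton rows r08.20, r08.23 of `HOME/lit-balaban-r08/SKELETON-r08.md`).
-/

noncomputable section

open MeasureTheory intervalIntegral Set NormedSpace
open scoped Nat

namespace Literature.MathematicalPhysics.QuantumFieldTheory.Balaban1983to89.B11Eq22Remainder

section RealAlgebra

variable {𝔸 : Type*} [NormedRing 𝔸] [NormedAlgebra ℝ 𝔸] [CompleteSpace 𝔸]

/-- The weight `n(1 − t)^{n−1}` of the printed remainder `R_n(z) = ∫₀¹ dt n(1 − t)^{n−1} e^{tz}` (22)–(23).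
[cite: Balaban1985Variational, (23) p.281] -/
def weight (n : ℕ) (t : ℝ) : ℝ := n * (1 - t) ^ (n - 1)

/-- The printed remainder **`R_n(X) = ∫₀¹ dt n(1 − t)^{n−1} e^{tX}`** of (22)–(23), for `X` in a Banach algebra
(Bochner integral of `t ↦ n(1 − t)^{n−1} • exp (t • X)` over `[0, 1]`). [cite: Balaban1985Variational, (22)–(23) p.281] -/
def expRemainder (n : ℕ) (X : 𝔸) : 𝔸 := ∫ t in (0 : ℝ)..1, weight n t • exp (t • X)

/-- The Taylor polynomial `Σ_{m<n} X^m/m!` of the exponential, the polynomial part of (22).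
[cite: Balaban1985Variational, (22) p.281] -/
def taylorPoly (n : ℕ) (X : 𝔸) : 𝔸 := ∑ m ∈ Finset.range n, ((m ! : ℝ)⁻¹) • X ^ m

omit [CompleteSpace 𝔸] in
/-- `taylorPoly (n+1) X = taylorPoly n X + X^n/n!`. [cite: Balaban1985Variational, (22) p.281] -/
theorem taylorPoly_succ (n : ℕ) (X : 𝔸) :
    taylorPoly (n + 1) X = taylorPoly n X + ((n ! : ℝ)⁻¹) • X ^ n := by
  simp [taylorPoly, Finset.sum_range_succ]

omit [CompleteSpace 𝔸] in
/-- `taylorPoly 1 X = 1`. [cite: Balaban1985Variational, (22) p.281] -/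
theorem taylorPoly_one (X : 𝔸) : taylorPoly 1 X = 1 := by
  simp [taylorPoly]

/-- `t ↦ e^{tX}` is differentiable with derivative `X e^{tX}` (one-parameter subgroup; Mathlib
`hasDerivAt_exp_smul_const'`). [cite: Balaban1985Variational, (22)–(23) p.281] -/
theorem hasDerivAt_exp_smul (X : 𝔸) (t : ℝ) :
    HasDerivAt (fun s : ℝ => exp (s • X)) (X * exp (t • X)) t :=
  hasDerivAt_exp_smul_const' (𝕂 := ℝ) X t

/-- Continuity of `t ↦ e^{tX}`. [cite: Balaban1985Variational, (22)–(23) p.281] -/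
theorem continuous_exp_smul (X : 𝔸) : Continuous fun s : ℝ => exp (s • X) :=
  continuous_iff_continuousAt.2 fun t => (hasDerivAt_exp_smul X t).continuousAt

/-- Continuity of the weight `n(1 − t)^{n−1}`. [cite: Balaban1985Variational, (23) p.281] -/
theorem continuous_weight (n : ℕ) : Continuous (weight n) := by
  unfold weight; fun_prop

/-- The integrand of `R_n` is interval-integrable on every interval. [cite: Balaban1985Variational, (23) p.281] -/
theorem intervalIntegrable_weight_smul_exp (n : ℕ) (X : 𝔸) (a b : ℝ) :
    IntervalIntegrable (fun t : ℝ => weight n t • exp (t • X)) volume a b :=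
  ((continuous_weight n).smul (continuous_exp_smul X)).intervalIntegrable a b

/-- `∫₀¹ n(1 − t)^{n−1} dt = 1` for `n ≥ 1` (the normalisation behind `|R_n(iX)| ≤ 1`).
[cite: Balaban1985Variational, (23) p.281] -/
theorem integral_weight {n : ℕ} (hn : n ≠ 0) : ∫ t in (0 : ℝ)..1, weight n t = 1 := by
  have hderiv : ∀ t ∈ uIcc (0 : ℝ) 1, HasDerivAt (fun s : ℝ => -((1 - s) ^ n)) (weight n t) t := by
    intro t _
    have h1 : HasDerivAt (fun s : ℝ => 1 - s) (-1) t := by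
      simpa using (hasDerivAt_id t).const_sub 1
    have h3 := (h1.pow (n := n)).neg
    refine h3.congr_deriv ?_
    simp only [weight, mul_neg_one, neg_neg]
  rw [integral_eq_sub_of_hasDerivAt hderiv ((continuous_weight n).intervalIntegrable (μ := volume) 0 1)]
  simp [zero_pow hn]

omit [CompleteSpace 𝔸] in
/-- `R_0 = 0` (the print only uses `n ≥ 1`). [cite: Balaban1985Variational, (23) p.281] -/
theorem expRemainder_zero (X : 𝔸) : expRemainder 0 X = 0 := by
  simp only [expRemainder, weight, Nat.cast_zero, zero_mul, zero_smul, intervalIntegral.integral_zero]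

/-- **Base of (22): `X · R₁(X) = e^X − 1`** (fundamental theorem of calculus for `t ↦ e^{tX}`).
[cite: Balaban1985Variational, (22)–(23) p.281] -/
theorem mul_expRemainder_one (X : 𝔸) : X * expRemainder 1 X = exp X - 1 := by
  have hR : expRemainder 1 X = ∫ t in (0 : ℝ)..1, exp (t • X) := by
    simp [expRemainder, weight]
  have hcomm : X * (∫ t in (0 : ℝ)..1, exp (t • X)) = ∫ t in (0 : ℝ)..1, X * exp (t • X) := by
    have := (ContinuousLinearMap.mul ℝ 𝔸 X).intervalIntegral_comp_comm
      ((continuous_exp_smul X).intervalIntegrable (μ := volume) 0 1)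
    simpa using this.symm
  rw [hR, hcomm]
  have hderiv : ∀ t ∈ uIcc (0 : ℝ) 1, HasDerivAt (fun s : ℝ => exp (s • X)) (X * exp (t • X)) t :=
    fun t _ => hasDerivAt_exp_smul X t
  rw [integral_eq_sub_of_hasDerivAt hderiv
    ((continuous_const.mul (continuous_exp_smul X)).intervalIntegrable (μ := volume) 0 1)]
  simp

/-- **Integration by parts for `R_n`: `R_n(X) = 1 + (n+1)⁻¹ X R_{n+1}(X)`** for `n ≥ 1` (the derivative of
`t ↦ (1 − t)^n e^{tX}` is `(1 − t)^n X e^{tX} − n(1 − t)^{n−1} e^{tX}`, and its integral over `[0, 1]` is `−1`).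
[cite: Balaban1985Variational, (22)–(23) p.281] -/
theorem expRemainder_eq_one_add {n : ℕ} (hn : n ≠ 0) (X : 𝔸) :
    expRemainder n X = 1 + ((n + 1 : ℝ)⁻¹) • (X * expRemainder (n + 1) X) := by
  -- the two integrands
  set E : ℝ → 𝔸 := fun t => exp (t • X) with hE
  have hcE := continuous_exp_smul X
  have hp : ∀ t : ℝ, HasDerivAt (fun s : ℝ => (1 - s) ^ n) (-(weight n t)) t := by
    intro t
    have h1 : HasDerivAt (fun s : ℝ => 1 - s) (-1) t := by
      simpa using (hasDerivAt_id t).const_sub 1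
    refine (h1.pow (n := n)).congr_deriv ?_
    simp only [weight, mul_neg_one]
  -- F(t) = (1-t)^n • E t, F' = (1-t)^n • (X * E t) + (-(weight n t)) • E t
  have hF : ∀ t ∈ uIcc (0 : ℝ) 1, HasDerivAt (fun s : ℝ => ((1 - s) ^ n) • E s)
      (((1 - t) ^ n) • (X * E t) + (-(weight n t)) • E t) t := by
    intro t _
    exact (hp t).smul (hasDerivAt_exp_smul X t)
  have hint1 : IntervalIntegrable (fun t : ℝ => ((1 - t) ^ n) • (X * E t)) volume 0 1 :=
    ((by fun_prop : Continuous fun t : ℝ => (1 - t) ^ n).smul (continuous_const.mul hcE)).intervalIntegrable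
      (μ := volume) 0 1
  have hint2 : IntervalIntegrable (fun t : ℝ => (-(weight n t)) • E t) volume 0 1 :=
    ((continuous_weight n).neg.smul hcE).intervalIntegrable (μ := volume) 0 1
  have hFTC := integral_eq_sub_of_hasDerivAt hF (hint1.add hint2)
  -- evaluate the boundary terms: F 1 - F 0 = 0 - 1
  have hbdry : ((1 - (1 : ℝ)) ^ n) • E 1 - ((1 - (0 : ℝ)) ^ n) • E 0 = -1 := by
    simp [hE, zero_pow hn]
  rw [hbdry, intervalIntegral.integral_add hint1 hint2] at hFTC
  -- identify the two integrals
  have hI2 : (∫ t in (0 : ℝ)..1, (-(weight n t)) • E t) = -expRemainder n X := by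
    simp only [neg_smul, intervalIntegral.integral_neg, expRemainder, hE]
  have hI1 : (∫ t in (0 : ℝ)..1, ((1 - t) ^ n) • (X * E t)) =
      ((n + 1 : ℝ)⁻¹) • (X * expRemainder (n + 1) X) := by
    have hw : ∀ t : ℝ, ((1 - t) ^ n) • (X * E t) =
        ((n + 1 : ℝ)⁻¹) • (X * (weight (n + 1) t • E t)) := by
      intro t
      have hn1 : (n + 1 : ℝ) ≠ 0 := by positivity
      simp only [weight, Nat.add_sub_cancel, Nat.cast_add, Nat.cast_one, mul_smul_comm, smul_smul]
      congr 1
      field_simp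
    simp_rw [hw]
    rw [intervalIntegral.integral_smul]
    congr 1
    have := (ContinuousLinearMap.mul ℝ 𝔸 X).intervalIntegral_comp_comm
      (intervalIntegrable_weight_smul_exp (n + 1) X 0 1)
    simpa [expRemainder, hE] using this
  rw [hI1, hI2] at hFTC
  -- hFTC : (n+1)⁻¹ • (X * R_{n+1}) + -R_n = -1
  have := hFTC
  rw [← sub_eq_add_neg, sub_eq_iff_eq_add] at this
  rw [this]; abel

/-- **(22) at every order: `e^X = Σ_{m<n} X^m/m! + (X^n/n!) R_n(X)`** for `n ≥ 1`.
[cite: Balaban1985Variational, (22) p.281] -/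
theorem exp_eq_taylorPoly_add_remainder {n : ℕ} (hn : n ≠ 0) (X : 𝔸) :
    exp X = taylorPoly n X + ((n ! : ℝ)⁻¹) • (X ^ n * expRemainder n X) := by
  induction n with
  | zero => exact absurd rfl hn
  | succ n ih =>
    rcases Nat.eq_zero_or_pos n with rfl | hpos
    · -- n + 1 = 1
      simp [taylorPoly_one, mul_expRemainder_one]
    · rw [ih hpos.ne', taylorPoly_succ, expRemainder_eq_one_add hpos.ne' X, mul_add, mul_one, smul_add,
        add_assoc]
      congr 1
      rw [mul_smul_comm, smul_smul, ← mul_assoc, ← pow_succ]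
      congr 1
      rw [Nat.factorial_succ, Nat.cast_mul, mul_inv, Nat.cast_add, Nat.cast_one, mul_comm]

/-- **The printed (22)**: `U₁ = e^{iηA} = 1 + iηA + (iη)²/2! A² + (iη)³/3! A³ + (iη)⁴/4! A⁴R₄(iηA)`, in the form
`e^X = 1 + X + X²/2 + X³/6 + (X⁴/24) R₄(X)` for `X = iηA`. [cite: Balaban1985Variational, (22) p.281] -/
theorem exp_eq_taylor_four (X : 𝔸) :
    exp X = 1 + X + (2 : ℝ)⁻¹ • X ^ 2 + (6 : ℝ)⁻¹ • X ^ 3 + (24 : ℝ)⁻¹ • (X ^ 4 * expRemainder 4 X) := by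
  rw [exp_eq_taylorPoly_add_remainder (by norm_num : (4 : ℕ) ≠ 0) X]
  simp only [taylorPoly, Finset.sum_range_succ, Finset.sum_range_zero, Nat.factorial]
  norm_num

omit [CompleteSpace 𝔸] in
/-- `‖e^a‖ ≤ e^{‖a‖}` in a Banach algebra with `‖1‖ = 1` (termwise comparison of the exponential series) —
elementary API for the second clause of (23), `|R_n(X)| ≤ e^{|X|}` (`norm_expRemainder_le_exp_norm`).
[cite: Balaban1985Variational, (23) p.281] -/
private theorem norm_exp_le_exp_norm [NormOneClass 𝔸] (a : 𝔸) : ‖exp a‖ ≤ Real.exp ‖a‖ := by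
  rw [congrFun (exp_eq_tsum ℝ (𝔸 := 𝔸)) a, Real.exp_eq_exp_ℝ, congrFun (exp_eq_tsum ℝ (𝔸 := ℝ)) ‖a‖]
  have h1 : Summable fun n : ℕ => ‖(n !⁻¹ : ℝ) • a ^ n‖ := norm_expSeries_summable' (𝕂 := ℝ) a
  have h2 : Summable fun n : ℕ => (n !⁻¹ : ℝ) • ‖a‖ ^ n := by
    have := Real.summable_pow_div_factorial ‖a‖
    refine this.congr fun n => ?_
    rw [smul_eq_mul, div_eq_inv_mul]
  refine (norm_tsum_le_tsum_norm h1).trans (h1.tsum_le_tsum (fun n => ?_) h2)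
  rw [norm_smul, norm_inv, Real.norm_natCast, smul_eq_mul]
  exact mul_le_mul_of_nonneg_left (norm_pow_le a n) (by positivity)

omit [CompleteSpace 𝔸] in
/-- **(23), second clause: `|R_n(X)| ≤ e^{|X|}` for an arbitrary `X`** (here: in a Banach algebra with `‖1‖ = 1`):
`‖∫₀¹ n(1−t)^{n−1} e^{tX} dt‖ ≤ ∫₀¹ n(1−t)^{n−1} e^{‖X‖} dt = e^{‖X‖}`. [cite: Balaban1985Variational, (23) p.281] -/
theorem norm_expRemainder_le_exp_norm [NormOneClass 𝔸] (n : ℕ) (X : 𝔸) :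
    ‖expRemainder n X‖ ≤ Real.exp ‖X‖ := by
  rcases Nat.eq_zero_or_pos n with rfl | hn
  · simp [expRemainder_zero, Real.exp_nonneg]
  have hbound : ∀ᵐ t : ℝ ∂volume, t ∈ Ioc (0 : ℝ) 1 →
      ‖weight n t • exp (t • X)‖ ≤ weight n t * Real.exp ‖X‖ := by
    refine Filter.Eventually.of_forall fun t ht => ?_
    have hw : 0 ≤ weight n t := by
      have : 0 ≤ 1 - t := by linarith [ht.2]
      unfold weight; positivity
    rw [norm_smul, Real.norm_of_nonneg hw]
    refine mul_le_mul_of_nonneg_left ((norm_exp_le_exp_norm _).trans ?_) hw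
    refine Real.exp_le_exp.2 ?_
    calc ‖t • X‖ ≤ ‖t‖ * ‖X‖ := norm_smul_le t X
      _ ≤ 1 * ‖X‖ := by
          refine mul_le_mul_of_nonneg_right ?_ (norm_nonneg _)
          rw [Real.norm_of_nonneg ht.1.le]; exact ht.2
      _ = ‖X‖ := one_mul _
  calc ‖expRemainder n X‖ ≤ ∫ t in (0 : ℝ)..1, weight n t * Real.exp ‖X‖ :=
        norm_integral_le_of_norm_le zero_le_one hbound
          (((continuous_weight n).mul continuous_const).intervalIntegrable (μ := volume) 0 1)
    _ = Real.exp ‖X‖ := by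
        rw [intervalIntegral.integral_mul_const, integral_weight hn.ne', one_mul]

omit [CompleteSpace 𝔸] in
/-- The (31)-shape consequence for ONE exponential: `‖(X^n/n!) R_n(X)‖ ≤ (‖X‖^n/n!) e^{‖X‖}` — cf. the printed
*«|V₄(A, ∂p)| ≤ (1/4!)(|A|(∂p))⁴ e^{η|A|(∂p)}. (31)»* for the four-fold plaquette product, which is not defined here.
[cite: Balaban1985Variational, (31) p.282] -/
theorem norm_taylorTerm_le [NormOneClass 𝔸] (n : ℕ) (X : 𝔸) :
    ‖((n ! : ℝ)⁻¹) • (X ^ n * expRemainder n X)‖ ≤ (n ! : ℝ)⁻¹ * ‖X‖ ^ n * Real.exp ‖X‖ := by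
  rw [norm_smul, norm_inv, Real.norm_natCast, mul_assoc]
  refine mul_le_mul_of_nonneg_left ?_ (by positivity)
  exact (norm_mul_le _ _).trans
    (mul_le_mul (norm_pow_le X n) (norm_expRemainder_le_exp_norm n X) (norm_nonneg _) (by positivity))

end RealAlgebra

section CStar

variable {A : Type*} [CStarAlgebra A]

/-- In a C⋆-algebra, `e^{itX}` has norm `≤ 1` for selfadjoint `X` and real `t` (it is unitary:
Mathlib `selfAdjoint.expUnitary`, `CStarRing.norm_coe_unitary`). [cite: Balaban1985Variational, (23) p.281] -/
theorem norm_exp_smul_I_smul_le_one {X : A} (hX : IsSelfAdjoint X) (t : ℝ) :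
    ‖exp (t • (Complex.I • X))‖ ≤ 1 := by
  have hsa : IsSelfAdjoint (t • X) := (IsSelfAdjoint.all t).smul hX
  have hval : exp (t • (Complex.I • X)) = ((selfAdjoint.expUnitary ⟨t • X, hsa⟩ : unitary A) : A) := by
    rw [selfAdjoint.expUnitary_coe, smul_comm]
  rw [hval]
  nontriviality A
  exact (CStarRing.norm_coe_unitary _).le

/-- **(23), first clause: `|R_n(iX)| ≤ 1` for an arbitrary hermitian `X`** — in any C⋆-algebra, for `X`
selfadjoint: `‖∫₀¹ n(1−t)^{n−1} e^{itX} dt‖ ≤ ∫₀¹ n(1−t)^{n−1} dt = 1`.  (Hermitian matrices with the operator norm: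
the instance `Matrix.instCStarAlgebra`, scoped `Matrix.L2OpNorm`.) [cite: Balaban1985Variational, (23) p.281] -/
theorem norm_expRemainder_I_smul_le_one {X : A} (hX : IsSelfAdjoint X) (n : ℕ) :
    ‖expRemainder n (Complex.I • X)‖ ≤ 1 := by
  rcases Nat.eq_zero_or_pos n with rfl | hn
  · simp [expRemainder_zero]
  have hbound : ∀ᵐ t : ℝ ∂volume, t ∈ Ioc (0 : ℝ) 1 →
      ‖weight n t • exp (t • (Complex.I • X))‖ ≤ weight n t := by
    refine Filter.Eventually.of_forall fun t ht => ?_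
    have hw : 0 ≤ weight n t := by
      have : 0 ≤ 1 - t := by linarith [ht.2]
      unfold weight; positivity
    rw [norm_smul, Real.norm_of_nonneg hw]
    simpa using mul_le_mul_of_nonneg_left (norm_exp_smul_I_smul_le_one hX t) hw
  calc ‖expRemainder n (Complex.I • X)‖ ≤ ∫ t in (0 : ℝ)..1, weight n t :=
        norm_integral_le_of_norm_le zero_le_one hbound
          ((continuous_weight n).intervalIntegrable (μ := volume) 0 1)
    _ = 1 := integral_weight hn.ne'

/-! ### v2 append: (38) p. 284 — the real part of a near-identity holonomy -/

/-- `‖Re U − 1‖ ≤ ‖U − 1‖` in a C⋆-algebra, `Re U = ½(U + U*)` (Mathlib `realPart`): since `Re U − 1 = ½((U − 1) +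
(U − 1)*)` and `‖X*‖ = ‖X‖` — the step from (14)/(2) (a bound on `|U₀(∂p) − 1|`) to (38) (a bound on `|Re U₀(∂p) − 1|`).
[cite: Balaban1985Variational, (38) p.284] -/
theorem norm_realPart_sub_one_le (U : A) : ‖((realPart U : selfAdjoint A) : A) - 1‖ ≤ ‖U - 1‖ := by
  have h : ((realPart U : selfAdjoint A) : A) - 1 = (2 : ℝ)⁻¹ • ((U - 1) + star (U - 1)) := by
    rw [realPart_apply_coe, star_sub, star_one]
    module
  rw [h, norm_smul, norm_inv, Real.norm_two]
  have := norm_add_le (U - 1) (star (U - 1))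
  rw [norm_star] at this
  linarith

/-- **(38)** p. 284 [PDF 8]: *«We have Re U₀(∂p) = 1 + (Re U₀(∂p) − 1), and |η^{-2}(Re U₀(∂p) − 1)| < C₁B₃ε₁(L^jη)^{-2},
p ∈ Ω_j, (38) so the expression with Re U₀(∂p) − 1 has a hidden additional factor η².»* — from the assumption (14) (U₀ ∈
𝔘_k({Ω_j}, C₁B₃ε₁), i.e. (2): `|U₀(∂p) − 1| < C₁B₃ε₁η²(L^jη)^{-2}` for p ∈ Ω_j), with `K = C₁B₃ε₁`, `t = L^jη`, `η > 0`.
[cite: Balaban1985Variational, (38) p.284] -/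
theorem ineq38 (U : A) (K η t : ℝ) (hη : 0 < η) (h14 : ‖U - 1‖ < K * η ^ 2 * t⁻¹ ^ 2) :
    η⁻¹ ^ 2 * ‖((realPart U : selfAdjoint A) : A) - 1‖ < K * t⁻¹ ^ 2 := by
  have h1 := norm_realPart_sub_one_le U
  have hη2 : 0 < η⁻¹ ^ 2 := by positivity
  calc η⁻¹ ^ 2 * ‖((realPart U : selfAdjoint A) : A) - 1‖ ≤ η⁻¹ ^ 2 * ‖U - 1‖ :=
        mul_le_mul_of_nonneg_left h1 hη2.le
    _ < η⁻¹ ^ 2 * (K * η ^ 2 * t⁻¹ ^ 2) := mul_lt_mul_of_pos_left h14 hη2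
    _ = K * t⁻¹ ^ 2 := by field_simp

end CStar

end Literature.MathematicalPhysics.QuantumFieldTheory.Balaban1983to89.B11Eq22Remainder

end
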